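import Literature.Algebra.Homology.DiscreteRepStandardResolution
import Literature.Algebra.Homology.ExtOfAcyclicResolutionNaturality
import Mathlib.RepresentationTheory.Homological.ContCohomology.Functoriality
import HarnessLib

/-!
# Naturality in the module of the comparison `Extⁿ_{C_Γ}(k, M) ≅ Hⁿ_cont(Γ, M)`

Topic `Algebra/Homology`; namespace `Literature.Algebra.Homology.DiscreteRep`.  Sequel of
`DiscreteRepStandardResolution` (the comparison `extTrivAddEquivContinuousCohomology`) and
`ExtOfAcyclicResolutionNaturality` (naturality of `Extⁿ(X, M) ≅ Hⁿ(Ext⁰(X, I•))` in the resolution);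
no `sorry`, no named fact.

For a morphism `f : X ⟶ Y` of topologically discrete representations of a COMPACT group `Γ` with open
stabilisers, Mathlib's standard complexes are functorial (`ContinuousCohomology.resolutionMap`,
`cochainsMap`), so `f` induces a morphism of the acyclic resolutions of `DiscreteRepStandardResolution`;
`ExtOfAcyclicResolutionNaturality` then gives the commutative square

  `Extⁿ_{C_Γ}(k, X) ≃+ Hⁿ_cont(Γ, X)`
  `     | f_*              | Hⁿ(f)`
  `Extⁿ_{C_Γ}(k, Y) ≃+ Hⁿ_cont(Γ, Y)`

(`extTrivAddEquivContinuousCohomology_naturality`), i.e. the comparison of Harari, Remark 4.24 is an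
isomorphism of FUNCTORS `C_Γ → Ab` on the topologically discrete objects (for Mathlib's
`ContinuousCohomology.map (ContinuousMonoidHom.id Γ) f`).

## What is here
* `stdBaseMap`, `stdComplexMap` (the morphism of standard complexes in `C_Γ` induced by `f`),
  `stdη_naturality`; `cochainsAbMap`; `extComplexIso_naturality`, `extComplexHomologyIso_naturality`;
  **`extTrivAddEquivContinuousCohomology_naturality`** and the Galois form
  **`extTrivAddEquivGaloisCohomology_naturality`** (for the tree's `galoisCohomology.map`).

## References
* D. Harari, *Galois Cohomology and Class Field Theory* (2020), §4.3, Remark 4.24. [Harari2020]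
* C. A. Weibel, *An introduction to homological algebra* (1994), §2.4, Thm. 2.7.6. [Weibel1994]
-/

noncomputable section

universe u

namespace Literature.Algebra.Homology

namespace DiscreteRep

open CategoryTheory CategoryTheory.Limits CategoryTheory.Abelian TopRep ContRepresentation
  ContinuousCohomology

variable {k Γ : Type u} [CommRing k] [TopologicalSpace k] [Group Γ] [TopologicalSpace Γ]
  [IsTopologicalGroup Γ] [CompactSpace Γ]
  {X Y : TopRep.{u} k Γ} [DiscreteTopology X.V] [DiscreteTopology Y.V]
  (hX : IsDiscrete ((forgetTop k Γ).obj X)) (hY : IsDiscrete ((forgetTop k Γ).obj Y)) (f : X ⟶ Y)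

/-! ## §1 The morphism of standard complexes induced by `f` -/

/-- `f` as a morphism `stdBase X ⟶ stdBase Y` of `C_Γ`. [cite: Harari2020, §4.3] -/
def stdBaseMap : stdBase X hX ⟶ stdBase Y hY :=
  ObjectProperty.homMk (X := stdObj X hX 0) (Y := stdObj Y hY 0) ((forgetTop k Γ).map f)

/-- The morphism of standard complexes in `C_Γ` induced by `f` (Mathlib's `resolutionMap` along the
identity of `Γ`: `F ↦ f ∘ F` iterated). [cite: Harari2020, §4.3] -/
def stdComplexMap : stdComplex X hX ⟶ stdComplex Y hY where
  f n := ObjectProperty.homMk (X := stdObj X hX (n + 1)) (Y := stdObj Y hY (n + 1))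
    ((forgetTop k Γ).map (resolutionMap (ContinuousMonoidHom.id Γ) (X := X) (Y := Y) f (n + 1)))
  comm' i j hij := by
    obtain rfl : i + 1 = j := hij
    rw [stdComplex_d, stdComplex_d]
    refine ObjectProperty.hom_ext _ (Rep.hom_ext (DFunLike.ext _ _ fun v => ?_))
    change (TopRep.d Y (i + 1)).hom ((resolutionMap (ContinuousMonoidHom.id Γ) f (i + 1)).hom v) =
      (resolutionMap (ContinuousMonoidHom.id Γ) f (i + 1 + 1)).hom ((TopRep.d X (i + 1)).hom v)
    exact congrArg (fun T => TopRep.Hom.hom T v)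
      (resolutionMap_comp_d (ContinuousMonoidHom.id Γ) (X := X) (Y := Y) f (i + 1))

/-- Components of `stdComplexMap`, elementwise. [cite: Harari2020, §4.3] -/
@[simp]
theorem stdComplexMap_f_apply (n : ℕ) (v : (resolutionX X (n + 1)).V) :
    ((stdComplexMap hX hY f).f n).hom.hom v =
      (resolutionMap (ContinuousMonoidHom.id Γ) (X := X) (Y := Y) f (n + 1)).hom v := rfl

/-- The augmentations commute with `f`. [cite: Harari2020, §4.3] -/
theorem stdη_naturality :
    stdη X hX ≫ (stdComplexMap hX hY f).f 0 = stdBaseMap hX hY f ≫ stdη Y hY := by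
  refine ObjectProperty.hom_ext _ (Rep.hom_ext (DFunLike.ext _ _ fun v => ?_))
  change (resolutionMap (ContinuousMonoidHom.id Γ) f (0 + 1)).hom ((TopRep.d X 0).hom v) =
    (TopRep.d Y 0).hom (f.hom v)
  exact (congrArg (fun T => TopRep.Hom.hom T v)
    (resolutionMap_comp_d (ContinuousMonoidHom.id Γ) (X := X) (Y := Y) f 0)).symm

/-! ## §2 Naturality of the identification with Mathlib's homogeneous cochains -/

/-- Mathlib's cochain map on homogeneous cochains, pushed to `Ab`. [cite: Harari2020, §4.3] -/
abbrev cochainsAbMap : cochainsAb X ⟶ cochainsAb Y :=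
  ((forgetAb k).mapHomologicalComplex (ComplexShape.up ℕ)).map
    (cochainsMap (ContinuousMonoidHom.id Γ) (X := X) (Y := Y) f)

/-- **`extComplexIso` is natural in the representation.** [cite: Harari2020, §4.3, Remark 4.24] -/
theorem extComplexIso_naturality :
    AcyclicResolution.extComplexMap (triv (Γ := Γ) k) (stdComplexMap hX hY f) ≫ (extComplexIso Y hY).hom =
      (extComplexIso X hX).hom ≫ cochainsAbMap f := by
  refine HomologicalComplex.hom_ext _ _ fun n => ?_
  rw [HomologicalComplex.comp_f, HomologicalComplex.comp_f]
  ext x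
  apply Subtype.ext
  change (Ext.addEquiv₀ (x.comp (Ext.mk₀ ((stdComplexMap hX hY f).f n)) (add_zero 0))).hom.hom (1 : k) =
    (resolutionMap (ContinuousMonoidHom.id Γ) (X := X) (Y := Y) f (n + 1)).hom
      ((Ext.addEquiv₀ x).hom.hom (1 : k))
  rw [addEquiv₀_comp_mk₀]
  rfl

/-- **`extComplexHomologyIso` is natural in the representation**: `Hⁿ(φ_*)` corresponds to Mathlib's
`ContinuousCohomology.map (id Γ) f`. [cite: Harari2020, §4.3, Remark 4.24] -/
theorem extComplexHomologyIso_naturality (n : ℕ) :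
    HomologicalComplex.homologyMap
        (AcyclicResolution.extComplexMap (triv (Γ := Γ) k) (stdComplexMap hX hY f)) n ≫
        (extComplexHomologyIso Y hY n).hom =
      (extComplexHomologyIso X hX n).hom ≫
        (forgetAb k).map (ContinuousCohomology.map (ContinuousMonoidHom.id Γ) (X := X) (Y := Y) f n) := by
  have h1 : HomologicalComplex.homologyMap
      (AcyclicResolution.extComplexMap (triv (Γ := Γ) k) (stdComplexMap hX hY f)) n ≫
      ((HomologicalComplex.homologyFunctor _ _ n).mapIso (extComplexIso Y hY)).hom =
      ((HomologicalComplex.homologyFunctor _ _ n).mapIso (extComplexIso X hX)).hom ≫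
        HomologicalComplex.homologyMap (cochainsAbMap f) n := by
    change HomologicalComplex.homologyMap _ n ≫ HomologicalComplex.homologyMap _ n =
      HomologicalComplex.homologyMap _ n ≫ HomologicalComplex.homologyMap _ n
    rw [← HomologicalComplex.homologyMap_comp, ← HomologicalComplex.homologyMap_comp,
      extComplexIso_naturality]
  have h2 : HomologicalComplex.homologyMap (cochainsAbMap f) n ≫
      (((homogeneousCochains Y).sc n).mapHomologyIso (forgetAb k)).hom =
      (((homogeneousCochains X).sc n).mapHomologyIso (forgetAb k)).hom ≫
        (forgetAb k).map (ContinuousCohomology.map (ContinuousMonoidHom.id Γ) (X := X) (Y := Y) f n) :=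
    ShortComplex.mapHomologyIso_hom_naturality
      ((HomologicalComplex.shortComplexFunctor _ _ n).map
        (cochainsMap (ContinuousMonoidHom.id Γ) (X := X) (Y := Y) f)) (forgetAb k)
  change _ ≫ (_ ≫ _) = (_ ≫ _) ≫ _
  exact ((Category.assoc _ _ _).symm.trans (eq_whisker h1 _)).trans
    ((Category.assoc _ _ _).trans ((whisker_eq _ h2).trans (Category.assoc _ _ _).symm))

/-! ## §3 Naturality of the comparison -/

/-- The terms of both standard complexes are acyclic and both augmented complexes exact: the
abstract isomorphisms `Extⁿ(k, ·) ≃+ Hⁿ(Ext⁰(k, std))` are natural in `f`.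
[cite: Harari2020, §4.3, Remark 4.24][cite: Weibel1994, §2.4 Thm. 2.7.6] -/
theorem extTrivAddEquivExtComplexHomology_naturality (n : ℕ)
    (x : Ext (triv (Γ := Γ) k) (stdBase X hX) n) :
    (HomologicalComplex.homologyMap
        (AcyclicResolution.extComplexMap (triv (Γ := Γ) k) (stdComplexMap hX hY f)) n).hom
        (extTrivAddEquivExtComplexHomology X hX n x) =
      extTrivAddEquivExtComplexHomology Y hY n (x.comp (Ext.mk₀ (stdBaseMap hX hY f)) (add_zero n)) := by
  cases n with
  | zero =>
    exact AcyclicResolution.extAddEquivHomologyZero_naturality (triv (Γ := Γ) k)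
      (stdComplexMap hX hY f) (stdη X hX) (stdη_d X hX) (exact_stdη X hX) (stdη Y hY) (stdη_d Y hY)
      (exact_stdη Y hY) (stdBaseMap hX hY f) (stdη_naturality hX hY f) x
  | succ n =>
    exact AcyclicResolution.extAddEquivHomologySucc_naturality (triv (Γ := Γ) k)
      (stdComplexMap hX hY f) (stdη X hX) (stdη_d X hX) (exact_stdη X hX) (stdη Y hY) (stdη_d Y hY)
      (exact_stdη Y hY) (stdBaseMap hX hY f) (stdη_naturality hX hY f)
      (stdComplex_exactAt_succ X hX) (ext_triv_stdComplex_X_eq_zero X hX)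
      (stdComplex_exactAt_succ Y hY) (ext_triv_stdComplex_X_eq_zero Y hY) n x

/-- **NATURALITY OF THE COMPARISON `Extⁿ_{C_Γ}(k, ·) ≃+ Hⁿ_cont(Γ, ·)` IN THE MODULE**: for a morphism
`f : X ⟶ Y` of topologically discrete representations of the compact group `Γ` with open stabilisers,
`Hⁿ(f) (Φ_X x) = Φ_Y (f_* x)` with `Hⁿ(f)` Mathlib's `ContinuousCohomology.map (id Γ) f` and `f_*`
postcomposition in `Ext`. [cite: Harari2020, §4.3, Remark 4.24] -/
theorem extTrivAddEquivContinuousCohomology_naturality (n : ℕ)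
    (x : Ext (triv (Γ := Γ) k) (stdBase X hX) n) :
    (ContinuousCohomology.map (ContinuousMonoidHom.id Γ) (X := X) (Y := Y) f n).hom
        (extTrivAddEquivContinuousCohomology X hX n x) =
      extTrivAddEquivContinuousCohomology Y hY n
        (x.comp (Ext.mk₀ (stdBaseMap hX hY f)) (add_zero n)) := by
  change ((extComplexHomologyIso X hX n).hom ≫ (forgetAb k).map
      (ContinuousCohomology.map (ContinuousMonoidHom.id Γ) (X := X) (Y := Y) f n)).hom
      (extTrivAddEquivExtComplexHomology X hX n x) =
    (extComplexHomologyIso Y hY n).hom.hom (extTrivAddEquivExtComplexHomology Y hY n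
      (x.comp (Ext.mk₀ (stdBaseMap hX hY f)) (add_zero n)))
  rw [← extComplexHomologyIso_naturality, ← extTrivAddEquivExtComplexHomology_naturality]
  rfl

end DiscreteRep

/-! ## §4 The Galois case -/

namespace DiscreteRep

open CategoryTheory CategoryTheory.Abelian Literature.NumberTheory.GaloisRepresentations Field
open scoped ContRepresentation

variable {K : Type} [Field K] [CompactSpace (absoluteGaloisGroup K)] {M N : Type} [AddCommGroup M]
  [TopologicalSpace M] [DiscreteTopology M] [AddCommGroup N] [TopologicalSpace N] [DiscreteTopology N]

/-- A continuous equivariant map of discrete Galois modules as a morphism of `C_{Γ_K}`.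
[cite: Harari2020, §4.2] -/
def ofDiscreteGaloisModuleMap (ρ : DiscreteGaloisModule K M) (ρ' : DiscreteGaloisModule K N)
    (f : ρ.toContRepresentation →ⁱL ρ'.toContRepresentation) :
    ofDiscreteGaloisModule ρ ⟶ ofDiscreteGaloisModule ρ' :=
  ObjectProperty.homMk (X := ofDiscreteGaloisModule ρ) (Y := ofDiscreteGaloisModule ρ')
    (Rep.ofHom f.toIntertwiningMap)

/-- **Naturality of `Extⁿ(ℤ, M) ≃+ Hⁿ(K, M)` in the Galois module**, for the tree's
`galoisCohomology.map`. [cite: Harari2020, §4.3, Remark 4.24] -/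
theorem extTrivAddEquivGaloisCohomology_naturality (ρ : DiscreteGaloisModule K M)
    (ρ' : DiscreteGaloisModule K N) (f : ρ.toContRepresentation →ⁱL ρ'.toContRepresentation) (n : ℕ)
    (x : Ext (triv (Γ := absoluteGaloisGroup K) ℤ) (ofDiscreteGaloisModule ρ) n) :
    galoisCohomology.map f n (extTrivAddEquivGaloisCohomology ρ n x) =
      extTrivAddEquivGaloisCohomology ρ' n
        (x.comp (Ext.mk₀ (ofDiscreteGaloisModuleMap ρ ρ' f)) (add_zero n)) :=
  extTrivAddEquivContinuousCohomology_naturality (k := ℤ) (X := ρ.toTopRep) (Y := ρ'.toTopRep)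
    (isDiscrete_of_continuousRep ρ) (isDiscrete_of_continuousRep ρ')
    (TopRep.ofHom ⟨f.toContinuousLinearMap, f.isIntertwining'⟩) n x

end DiscreteRep

end Literature.Algebra.Homology
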